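import Mathlib
import Summits.ValiantsHypothesis.ValiantsHypothesis.Theorems.LacunarySymmetroidMatrixDescartesFrozenInertia
import Summits.ValiantsHypothesis.ValiantsHypothesis.Theorems.LacunarySymmetroidMatrixDescartesGramDualHaynsworth
import Summits.ValiantsHypothesis.ValiantsHypothesis.Theorems.LacunarySymmetroidMatrixDescartesGramDualSplitting
import Summits.ValiantsHypothesis.ValiantsHypothesis.Theorems.LacunarySymmetroidMatrixDescartesInertiaEndInertias

/-!
# `MatrixDescartes` (stmt-ValiantsHypothesis-18050) — THE INERTIA BAND LAW: columns outside a sign-coherent core move the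
# inertia of a word by at most their number — `ν(B) − #{extra positive columns} ≤ ν(F(x)) ≤ ν(B) + #{extra negative columns}`
# at every positive scale, with the exact Schur-complement bookkeeping

HONEST FRAMING.  Cell `pub-symmetroid`, seat `val-sym-mdr-p2` (gen 20); helper file `--supports` the crux
`Theses.LacunarySymmetroid.MatrixDescartes` (OPEN), NO closure claim; companion of `…FrozenInertia` (coherent core ⇒ inertia
of the base, frozen) through Haynsworth's additivity (`…GramDualHaynsworth`) and the inertia duality (`…GramDualInertiaDuality`).
A STRUCTURE theorem (two-sided, all sizes, all exponents); nothing here bears on the crux in its window, `stub_twoSided`,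
`DoorA26` / `DoorA34`, registers, or `VP ≠ VNP`.

SETTING.  `B` real symmetric, `det B ≠ 0`; two column groups: the CORE `U₀` (signs `σ₀`, exponents `δ₀`) whose Gram matrix
`U₀ᵀB⁻¹U₀` is SIGN-COHERENT (PSD on the `σ₀`-positive columns, NSD on the `σ₀`-negative ones — the sterile sector of
`…GramDualCoherent`), and `k = |ρ₁|` EXTRA columns `U₁` (signs `σ₁ ≠ 0`, exponents `δ₁`) with NO hypothesis; the word is
`F(x) = x^eB + U₀ diag(σ₀x^{δ₀}) U₀ᵀ + U₁ diag(σ₁x^{δ₁}) U₁ᵀ`.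

* `eval_dual_fromCols` — the dual of the juxtaposed word at scale `x` is the block matrix `[[𝔸(x), 𝔹(x)], [𝔹(x)ᵀ, 𝔻₁(x)]]`
  with `𝔸(x)` the (quasi-definite, invertible) dual of the core, `𝔹(x) = x^{E−e}·U₀ᵀB⁻¹U₁`, `𝔻₁(x)` the dual of the extras.
* **`negIndex_word_eq_schur` (EXACT BOOKKEEPING, both indices).**  With `𝕊(x) = 𝔻₁(x) − 𝔹(x)ᵀ𝔸(x)⁻¹𝔹(x)` the
  `k × k` SCHUR COMPLEMENT of the core in the dual:  `ν(F(x)) + #{σ₁ > 0} = ν(B) + π(𝕊(x))` and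
  `π(F(x)) + #{σ₁ < 0} = π(B) + ν(𝕊(x))` at every `x > 0` (inertia duality + Haynsworth + frozen core
  `π(𝔸(x)) = #{σ₀>0}`, `ν(𝔸(x)) = #{σ₀<0}`).  The whole inertia walk of the word is the inertia walk of a `k × k` matrix function.
* **`inertia_word_band` (THE INERTIA BAND LAW), `inertia_word_band_psd` (PSD letters, PSD-Gram core).**  For every `x > 0`:
  `ν(B) ≤ ν(F(x)) + #{j : σ₁ⱼ > 0}` and `ν(F(x)) + #{j : σ₁ⱼ > 0} ≤ ν(B) + k`, i.e.
  `ν(B) − #{extra positive columns} ≤ ν(F(x)) ≤ ν(B) + #{extra negative columns}`; likewise for `π`.  With an EMPTY extra group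
  this is the frozen-inertia theorem; with an empty core it is the trivial rank bound; the content is that only the columns
  OUTSIDE a coherent core are charged.  CONSEQUENCE for the lineage's inertia calculus (paper remark, kernel pieces all in the
  tree): on every window whose roots are of ONE type the number of roots with multiplicity is `|ν(F(b)) − ν(F(a))| ≤ k`
  (`Inertia.card_roots_Ioo_add_negIndex_eq_of_posType/negType`), so the inertia budget `m` of the one-type / definite-derivative
  window laws is replaced by the INCOHERENCE NUMBER `k`; the monotone (one-sided) case is filed separately.

[folklore] (Sylvester duality, Haynsworth inertia additivity, quasi-definite matrices).  Axioms `propext`, `Classical.choice`,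
`Quot.sound`.
-/

-- layout Summits/ValiantsHypothesis/ValiantsHypothesis forces the duplicated namespace component
set_option linter.dupNamespace false

namespace Summit.ValiantsHypothesis.ValiantsHypothesis.Theorems.LacunarySymmetroidMatrixDescartes

open Polynomial Matrix Finset
open scoped BigOperators

namespace GramDual

section Band

variable {ι ρ₀ ρ₁ : Type} [Fintype ι] [DecidableEq ι] [Fintype ρ₀] [DecidableEq ρ₀] [Fintype ρ₁] [DecidableEq ρ₁]
variable (B : Matrix ι ι ℝ) (U₀ : Matrix ι ρ₀ ℝ) (U₁ : Matrix ι ρ₁ ℝ) (σ₀ : ρ₀ → ℝ) (σ₁ : ρ₁ → ℝ) (E e : ℕ)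
  (δ₀ : ρ₀ → ℕ) (δ₁ : ρ₁ → ℕ)

/-- the evaluated dual of the core (file-local notation) -/
local notation3 (prettyPrint := false) "𝔸[" x "]" =>
  (Matrix.diagonal (fun j => (σ₀ j)⁻¹ * (x : ℝ) ^ (E - δ₀ j)) + (x : ℝ) ^ (E - e) • (U₀ᵀ * B⁻¹ * U₀))

/-- the evaluated cross block (file-local notation) -/
local notation3 (prettyPrint := false) "𝔹[" x "]" => ((x : ℝ) ^ (E - e) • (U₀ᵀ * B⁻¹ * U₁))

/-- the evaluated dual of the extra columns (file-local notation) -/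
local notation3 (prettyPrint := false) "𝔻₁[" x "]" =>
  (Matrix.diagonal (fun j => (σ₁ j)⁻¹ * (x : ℝ) ^ (E - δ₁ j)) + (x : ℝ) ^ (E - e) • (U₁ᵀ * B⁻¹ * U₁))

/-- the Schur complement of the core in the dual (file-local notation) -/
local notation3 (prettyPrint := false) "𝕊[" x "]" => (𝔻₁[x] - (𝔹[x])ᵀ * (𝔸[x])⁻¹ * 𝔹[x])

/-- the evaluated juxtaposed word (file-local notation) -/
local notation3 (prettyPrint := false) "𝔽[" x "]" =>
  ((x : ℝ) ^ e • B + Matrix.fromCols U₀ U₁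
      * Matrix.diagonal (fun j => Sum.elim σ₀ σ₁ j * (x : ℝ) ^ (Sum.elim δ₀ δ₁ j)) * (Matrix.fromCols U₀ U₁)ᵀ)

/-! ## §1  Bookkeeping: block form of the dual, symmetry, counting over a sum type -/

omit [Fintype ρ₀] [DecidableEq ρ₀] [Fintype ρ₁] [DecidableEq ρ₁] in
/-- The cross Gram blocks are transposes of each other (symmetric base). [folklore] -/
theorem transpose_gram_cross (hBs : B.IsSymm) : (U₀ᵀ * B⁻¹ * U₁)ᵀ = U₁ᵀ * B⁻¹ * U₀ := by
  rw [Matrix.transpose_mul, Matrix.transpose_mul, Matrix.transpose_transpose, Matrix.transpose_nonsing_inv, hBs.eq,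
    Matrix.mul_assoc]

omit [Fintype ρ₀] [Fintype ρ₁] in
/-- **Block form of the evaluated dual of a juxtaposed word.** [folklore] -/
theorem eval_dual_fromCols (hBs : B.IsSymm) (x : ℝ) :
    Matrix.diagonal (fun j => (Sum.elim σ₀ σ₁ j)⁻¹ * x ^ (E - Sum.elim δ₀ δ₁ j))
        + x ^ (E - e) • ((Matrix.fromCols U₀ U₁)ᵀ * B⁻¹ * Matrix.fromCols U₀ U₁)
      = Matrix.fromBlocks (𝔸[x]) (𝔹[x]) ((𝔹[x])ᵀ) (𝔻₁[x]) := by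
  have hdiag : Matrix.diagonal (fun j : ρ₀ ⊕ ρ₁ => (Sum.elim σ₀ σ₁ j)⁻¹ * x ^ (E - Sum.elim δ₀ δ₁ j))
      = Matrix.fromBlocks (Matrix.diagonal fun j => (σ₀ j)⁻¹ * x ^ (E - δ₀ j)) 0 0
          (Matrix.diagonal fun j => (σ₁ j)⁻¹ * x ^ (E - δ₁ j)) := by
    rw [Matrix.fromBlocks_diagonal]
    congr 1
    funext j
    cases j <;> rfl
  rw [gram_fromCols, hdiag, Matrix.fromBlocks_smul, Matrix.fromBlocks_add, Matrix.transpose_smul,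
    transpose_gram_cross B U₀ U₁ hBs]
  simp only [zero_add]

omit [Fintype ρ₀] [DecidableEq ρ₁] in
/-- The core dual is symmetric. [folklore] -/
theorem isSymm_coreDual (hBs : B.IsSymm) (x : ℝ) : (𝔸[x]).IsSymm :=
  (Matrix.isSymm_diagonal _).add ((isSymm_gram hBs U₀).smul _)

omit [Fintype ρ₁] in
/-- The Schur complement of the core is symmetric. [folklore] -/
theorem isSymm_schur (hBs : B.IsSymm) (x : ℝ) : (𝕊[x]).IsSymm :=
  ((Matrix.isSymm_diagonal _).add ((isSymm_gram hBs U₁).smul _)).sub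
    (isSymm_conj (isSymm_inv (isSymm_coreDual B U₀ σ₀ E e δ₀ hBs x)) _)

omit [Fintype ι] [DecidableEq ι] [DecidableEq ρ₀] [DecidableEq ρ₁] in
/-- Counting a subtype over a sum type. [folklore] -/
theorem card_subtype_sum (p : ρ₀ ⊕ ρ₁ → Prop) [DecidablePred p] :
    Fintype.card {j // p j} = Fintype.card {a // p (Sum.inl a)} + Fintype.card {b // p (Sum.inr b)} := by
  classical
  rw [Fintype.card_subtype, Fintype.card_subtype, Fintype.card_subtype, Finset.card_filter, Finset.card_filter,
    Finset.card_filter, Fintype.sum_sum_type]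

/-! ## §2  The exact Schur-complement bookkeeping -/

/-- **EXACT BOOKKEEPING (negative index).**  Coherent core, arbitrary extras: for every `x > 0`,
`ν(F(x)) + #{j : σ₁ⱼ > 0} = ν(B) + π(𝕊(x))`, `𝕊(x)` the `k × k` Schur complement of the core in the dual. [folklore] -/
theorem negIndex_word_eq_schur (hBs : B.IsSymm) (hBu : IsUnit B.det) (hσ₀ : ∀ j, σ₀ j ≠ 0) (hσ₁ : ∀ j, σ₁ j ≠ 0)
    (he : e ≤ E) (hδ₀ : ∀ j, δ₀ j ≤ E) (hδ₁ : ∀ j, δ₁ j ≤ E)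
    (hP : ∀ v : ρ₀ → ℝ, (∀ j, σ₀ j < 0 → v j = 0) → 0 ≤ v ⬝ᵥ ((U₀ᵀ * B⁻¹ * U₀) *ᵥ v))
    (hN : ∀ v : ρ₀ → ℝ, (∀ j, 0 < σ₀ j → v j = 0) → v ⬝ᵥ ((U₀ᵀ * B⁻¹ * U₀) *ᵥ v) ≤ 0)
    {x : ℝ} (hx : 0 < x) (hB : B.IsHermitian) (hF : (𝔽[x]).IsHermitian) (hS : (𝕊[x]).IsHermitian) :
    Fintype.card {j // hF.eigenvalues j < 0} + Fintype.card {j // 0 < σ₁ j}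
        = Fintype.card {j // hB.eigenvalues j < 0} + Fintype.card {j // 0 < hS.eigenvalues j}
      ∧ Fintype.card {j // 0 < hF.eigenvalues j} + Fintype.card {j // σ₁ j < 0}
        = Fintype.card {j // 0 < hB.eigenvalues j} + Fintype.card {j // hS.eigenvalues j < 0} := by
  classical
  have hσ : ∀ j, Sum.elim σ₀ σ₁ j ≠ 0 := fun j => by cases j with | inl j => exact hσ₀ j | inr j => exact hσ₁ j
  have hδ : ∀ j, Sum.elim δ₀ δ₁ j ≤ E := fun j => by cases j with | inl j => exact hδ₀ j | inr j => exact hδ₁ j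
  -- hermitian witnesses
  have hD := isHermitian_eval_dual hBs (Matrix.fromCols U₀ U₁) (Sum.elim σ₀ σ₁) E e (Sum.elim δ₀ δ₁) x
  have hA : (𝔸[x]).IsHermitian := isHermitian_eval_dual hBs U₀ σ₀ E e δ₀ x
  have hM : (Matrix.fromBlocks (𝔸[x]) (𝔹[x]) ((𝔹[x])ᵀ) (𝔻₁[x])).IsHermitian := by
    have h := hD
    rw [eval_dual_fromCols B U₀ U₁ σ₀ σ₁ E e δ₀ δ₁ hBs x] at h
    exact h
  -- the inertia duality for the juxtaposed word
  have hν := negIndex_word_add_eq hBs hBu (Matrix.fromCols U₀ U₁) (Sum.elim σ₀ σ₁) hσ e E (Sum.elim δ₀ δ₁) he hδ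
    hx hB hF hD
  have hπ := posIndex_word_add_eq hBs hBu (Matrix.fromCols U₀ U₁) (Sum.elim σ₀ σ₁) hσ e E (Sum.elim δ₀ δ₁) he hδ
    hx hB hF hD
  -- the dual in block form
  have hDM_pos : Fintype.card {j // 0 < hD.eigenvalues j} = Fintype.card {j // 0 < hM.eigenvalues j} :=
    Inertia.posIndex_congr hD hM (eval_dual_fromCols B U₀ U₁ σ₀ σ₁ E e δ₀ δ₁ hBs x)
  have hDM_neg : Fintype.card {j // hD.eigenvalues j < 0} = Fintype.card {j // hM.eigenvalues j < 0} :=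
    Inertia.negIndex_congr hD hM (eval_dual_fromCols B U₀ U₁ σ₀ σ₁ E e δ₀ δ₁ hBs x)
  -- Haynsworth through the (quasi-definite, invertible) core block
  have hAu : IsUnit (𝔸[x]).det :=
    isUnit_iff_ne_zero.2 (det_dual_ne_zero_of_coherent B hBs U₀ σ₀ hσ₀ E e δ₀ hP hN hx)
  have hHπ := posIndex_fromBlocks_eq (isSymm_coreDual B U₀ σ₀ E e δ₀ hBs x) hAu (𝔹[x]) (𝔻₁[x]) hA hS hM
  have hHν := negIndex_fromBlocks_eq (isSymm_coreDual B U₀ σ₀ E e δ₀ hBs x) hAu (𝔹[x]) (𝔻₁[x]) hA hS hM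
  -- the core is frozen
  have hcore := inertia_dual_eq_of_coherent hBs U₀ σ₀ hσ₀ E e δ₀ hP hN hx
  have hA_pos : Fintype.card {j // 0 < hA.eigenvalues j} = Fintype.card {j // 0 < σ₀ j} := hcore.1
  have hA_neg : Fintype.card {j // hA.eigenvalues j < 0} = Fintype.card {j // σ₀ j < 0} := by
    rw [hcore.2]
    refine Fintype.card_congr (Equiv.subtypeEquivRight fun j => ?_)
    exact ⟨fun h => lt_of_le_of_ne (not_lt.1 h) (hσ₀ j), fun h => not_lt.2 h.le⟩
  -- counting the signs over the sum type
  have hcnt_pos : Fintype.card {j : ρ₀ ⊕ ρ₁ // 0 < Sum.elim σ₀ σ₁ j}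
      = Fintype.card {j // 0 < σ₀ j} + Fintype.card {j // 0 < σ₁ j} := card_subtype_sum (fun j => 0 < Sum.elim σ₀ σ₁ j)
  have hcnt_neg : Fintype.card {j : ρ₀ ⊕ ρ₁ // Sum.elim σ₀ σ₁ j < 0}
      = Fintype.card {j // σ₀ j < 0} + Fintype.card {j // σ₁ j < 0} := card_subtype_sum (fun j => Sum.elim σ₀ σ₁ j < 0)
  rw [hcnt_pos, hDM_pos, hHπ, hA_pos] at hν
  rw [hcnt_neg, hDM_neg, hHν, hA_neg] at hπ
  constructor <;> omega

/-! ## §3  The inertia band law -/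

/-- **THE INERTIA BAND LAW.**  `B` real symmetric non-degenerate; a SIGN-COHERENT core `U₀` (Gram matrix PSD on its positive
columns, NSD on its negative columns) and `k = |ρ₁|` extra columns `U₁` with non-zero signs and arbitrary exponents.  Then at
every `x > 0`:  `ν(B) ≤ ν(F(x)) + #{j : σ₁ⱼ > 0} ≤ ν(B) + k`  and  `π(B) ≤ π(F(x)) + #{j : σ₁ⱼ < 0} ≤ π(B) + k`
— the extra positive columns lower `ν` by at most their number, the extra negative columns raise it by at most theirs, and
the core is free. [folklore] -/
theorem inertia_word_band (hBs : B.IsSymm) (hBu : IsUnit B.det) (hσ₀ : ∀ j, σ₀ j ≠ 0) (hσ₁ : ∀ j, σ₁ j ≠ 0)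
    (hP : ∀ v : ρ₀ → ℝ, (∀ j, σ₀ j < 0 → v j = 0) → 0 ≤ v ⬝ᵥ ((U₀ᵀ * B⁻¹ * U₀) *ᵥ v))
    (hN : ∀ v : ρ₀ → ℝ, (∀ j, 0 < σ₀ j → v j = 0) → v ⬝ᵥ ((U₀ᵀ * B⁻¹ * U₀) *ᵥ v) ≤ 0)
    {x : ℝ} (hx : 0 < x) (hB : B.IsHermitian) (hF : (𝔽[x]).IsHermitian) :
    (Fintype.card {j // hB.eigenvalues j < 0} ≤ Fintype.card {j // hF.eigenvalues j < 0} + Fintype.card {j // 0 < σ₁ j}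
      ∧ Fintype.card {j // hF.eigenvalues j < 0} + Fintype.card {j // 0 < σ₁ j}
          ≤ Fintype.card {j // hB.eigenvalues j < 0} + Fintype.card ρ₁)
    ∧ (Fintype.card {j // 0 < hB.eigenvalues j} ≤ Fintype.card {j // 0 < hF.eigenvalues j} + Fintype.card {j // σ₁ j < 0}
      ∧ Fintype.card {j // 0 < hF.eigenvalues j} + Fintype.card {j // σ₁ j < 0}
          ≤ Fintype.card {j // 0 < hB.eigenvalues j} + Fintype.card ρ₁) := by
  classical
  obtain ⟨E', he, hδ⟩ := exists_bound e (Sum.elim δ₀ δ₁)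
  have hδ₀ : ∀ j, δ₀ j ≤ E' := fun j => hδ (Sum.inl j)
  have hδ₁ : ∀ j, δ₁ j ≤ E' := fun j => hδ (Sum.inr j)
  have hS := Inertia.isHermitian_of_isSymm (isSymm_schur B U₀ U₁ σ₀ σ₁ E' e δ₀ δ₁ hBs x)
  have h := negIndex_word_eq_schur B U₀ U₁ σ₀ σ₁ E' e δ₀ δ₁ hBs hBu hσ₀ hσ₁ he hδ₀ hδ₁ hP hN hx hB hF hS
  have h1 : Fintype.card {j // 0 < hS.eigenvalues j} ≤ Fintype.card ρ₁ := Fintype.card_subtype_le _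
  have h2 : Fintype.card {j // hS.eigenvalues j < 0} ≤ Fintype.card ρ₁ := Fintype.card_subtype_le _
  refine ⟨⟨?_, ?_⟩, ⟨?_, ?_⟩⟩ <;> omega

/-- **PSD letters: only the columns outside a PSD-Gram core are charged.**  All signs positive, core Gram `U₀ᵀB⁻¹U₀ ⪰ 0`:
`ν(B) − k ≤ ν(F(x)) ≤ ν(B)` and `π(B) ≤ π(F(x)) ≤ π(B) + k` at every `x > 0`. [folklore] -/
theorem inertia_word_band_psd (hBs : B.IsSymm) (hBu : IsUnit B.det) (hσ₀ : ∀ j, 0 < σ₀ j) (hσ₁ : ∀ j, 0 < σ₁ j)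
    (hC : (U₀ᵀ * B⁻¹ * U₀).PosSemidef) {x : ℝ} (hx : 0 < x) (hB : B.IsHermitian) (hF : (𝔽[x]).IsHermitian) :
    (Fintype.card {j // hB.eigenvalues j < 0} ≤ Fintype.card {j // hF.eigenvalues j < 0} + Fintype.card ρ₁
      ∧ Fintype.card {j // hF.eigenvalues j < 0} ≤ Fintype.card {j // hB.eigenvalues j < 0})
    ∧ (Fintype.card {j // 0 < hB.eigenvalues j} ≤ Fintype.card {j // 0 < hF.eigenvalues j}
      ∧ Fintype.card {j // 0 < hF.eigenvalues j} ≤ Fintype.card {j // 0 < hB.eigenvalues j} + Fintype.card ρ₁) := by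
  classical
  have h := inertia_word_band B U₀ U₁ σ₀ σ₁ e δ₀ δ₁ hBs hBu (fun j => (hσ₀ j).ne') (fun j => (hσ₁ j).ne')
    (fun v _ => by simpa only [star_trivial] using hC.dotProduct_mulVec_nonneg v)
    (fun v hv => by
      have hv0 : v = 0 := funext fun j => hv j (hσ₀ j)
      rw [hv0, Matrix.mulVec_zero, dotProduct_zero]) hx hB hF
  have hpos : Fintype.card {j // 0 < σ₁ j} = Fintype.card ρ₁ := by
    rw [Fintype.card_subtype, Finset.filter_true_of_mem fun j _ => hσ₁ j, Finset.card_univ]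
  have hneg : Fintype.card {j // σ₁ j < 0} = 0 := by
    rw [Fintype.card_eq_zero_iff]
    exact ⟨fun j => absurd j.2 (not_lt.2 (hσ₁ j.1).le)⟩
  rw [hpos, hneg] at h
  refine ⟨⟨?_, ?_⟩, ⟨?_, ?_⟩⟩ <;> omega

end Band

end GramDual

end Summit.ValiantsHypothesis.ValiantsHypothesis.Theorems.LacunarySymmetroidMatrixDescartes
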